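import Summits.NavierStokesRegularity.FluidComputer.GateBudgetPulse
import Summits.NavierStokesRegularity.FluidComputer.RotorKnobNecessity
import HarnessLib

/-!
# What no tuning can beat, part 11: THE PULSE FLIPS THE CLOCK, knob forms — reversal, transit and
# the logarithmic residence laws for the two-scale family `rotorCircuit K M ε ρ`

Cell `pub-fluidc`, blueprint seat bp1 (gen 26); same namespace and conventions as parts 1–10
(`GateBudget*.lean`); this part imports part 10 (`GateBudgetPulse`: radius, peak, reversal,
no-return, rise and decay residence laws for `fiveGateCircuit ε σ μ R K`) and `RotorKnobNecessity`
(gen 24: `rotorCircuit_eq_fiveGate`, the knob family IS the slice `σ = ρ²e^{-M}`, `μ = ε⁻¹M`,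
`R = (ρ²)⁻¹` of the five-gate circuit). HONEST FRAMING (verbatim): low prior, high
value-of-information experiment on Tao's machine paradigm; NOT a claim that NS blows up. Five-mode
quadratic ODEs on `ℝ⁵` started EXACTLY at (5.6) `delayInit`; Tao's (5.5) is the member `ρ = ε`,
`M = K¹⁰`; nothing is proved about the Navier–Stokes equations.

## What this part records

The cell's toys (data READMEs `pub-fluidc-bp1/data/g23-toy/`, `g25-toy/`) and the robust-firing
necessity programme (SPEC-INPUT-bp1 §S) speak the knob variables: clock `b ≈ ε·t`, catalyst
`u = c/ρ²` (`= R·c`, the rotor's turning rate), seed knob `σ_knob = ρ²/ε`, amplifier `M/ε`. In these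
variables part 10's laws read, for EVERY exact trajectory of EVERY member (`0 < ε`, `ρ² ≤ ε`,
`0 ≤ M`; window hypotheses assumed as in parts 5–10):

* §29a `knob_clock_flip`: on a window `[s,T]` on which `c ≥ η` with `Mη² ≥ ε²` (`η` just above the
  clock-killing level `ε/√M`), containing a zero of the clock and left by the trigger no higher
  than entered, `b(T) ≤ -√(b(s)² - 2ε²(T² - s²))` — the clock exits the pulse with its entry value,
  sign flipped (the toy's `b/ε ≈ -1.1 … -1.4` after firing at `t ≈ 1.1 … 1.5`, (P6));
* §29b `knob_clock_transit`: while `c ≥ γ` with `Mγ² > ε²` the clock crosses `[-β, β]` in time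
  `≤ 2εβ/(Mγ² - ε²)`;
* §29c `knob_rise_residence`: with the clock alive at `b ≥ β > 0`, `u` stays above `λ` for at most
  `(ε/(Mβ))·log(2εt/(λρ²))` (trigger budget `c ≤ (ε + ρ²e^{-M})t ≤ 2εt`);
* §29d `knob_decay_residence`: with the clock dead at `b ≤ -β`, `u` stays above `λ` for at most
  `(ε/(Mβ))·log(u(T)/(λ - εe^{-M}/(Mβ)))` (seed floor `εe^{-M}/(Mβ)` in `u`-units).

With `β ≈ ε` on both sides (reversal law) the residence of `u` above the over-turning threshold `λ`
of part 9's envelope law is `≲ (2/M)·log(u_max/λ)`, `u_max ≈ √2/σ_knob`: LOGARITHMIC in the pulse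
height — the quantity the necessity assembly S13″ multiplies by the drain rate `K`.

HONEST LIMITS. As part 10: window laws with ASSUMED window hypotheses; nothing about the carrier's
phase, the cascade, or NS. `0` named facts; `0` sorry.
[cite: Tao2016AveragedNS, §5.5 Theorem 5.3, (5.5), (5.6), (b-eq), proof (ob-2),
("comparison argument")].
-/

noncomputable section

namespace Summit.NavierStokesRegularity.FluidComputer.GateBudget

open Real Set Filter Topology
open Literature.Analysis.FluidPDE.Tao2016AveragedNS

variable {ε : ℝ}

/-! ## §29 Knob forms of the reversal, transit and residence laws (`u = c/ρ²`) -/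

/-- Bookkeeping for the knob family: with `0 < ρ² ≤ ε`, `0 ≤ M`: the seed `ρ²e^{-M} ≤ ε`, so the
trigger budget rate is `ε + ρ²e^{-M} ≤ 2ε`. [cite: Tao2016AveragedNS, §5.5 (5.5)] -/
theorem knob_seed_le (hε : 0 < ε) {ρ M : ℝ} (hρε : ρ ^ 2 ≤ ε) (hM : 0 ≤ M) :
    0 ≤ ρ ^ 2 * exp (-M) ∧ ρ ^ 2 * exp (-M) ≤ ε := by
  have h1 : exp (-M) ≤ 1 := exp_le_one_iff.2 (by linarith)
  refine ⟨by positivity, ?_⟩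
  nlinarith [mul_le_mul hρε h1 (exp_pos _).le hε.le]

/-- **THE PULSE FLIPS THE CLOCK, knob family.** Along `rotorCircuit K M ε ρ` (`ρ² ≤ ε`, `0 < ε`,
`0 ≤ M`; any `K`), on a window `[s,T] ⊆ [0,∞)` on which `c ≥ η` with `Mη² ≥ ε²` (i.e. `η ≥ ε/√M`:
just above the clock-killing level), containing a zero of the clock and left by the trigger no
higher than entered (`c(T) ≤ c(s)`): `b(T) ≤ -√(b(s)² - 2ε²(T² - s²))`.
[cite: Tao2016AveragedNS, §5.5 Theorem 5.3, (b-eq)] -/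
theorem knob_clock_flip {K M ε ρ : ℝ} {X : ℝ → Fin 5 → ℝ}
    (hX : ∀ t, HasDerivAt X (RotorKnob.rotorCircuit K M ε ρ (X t)) t) (h0 : X 0 = delayInit)
    (hε : 0 < ε) (hρε : ρ ^ 2 ≤ ε) (hM : 0 ≤ M) {s T η t₀ : ℝ} (hs : 0 ≤ s) (hη : 0 ≤ η)
    (hηε : ε ^ 2 ≤ M * η ^ 2) (hc : ∀ t ∈ Icc s T, η ≤ X t 2) (hcT : X T 2 ≤ X s 2)
    (ht₀ : t₀ ∈ Icc s T) (hb₀ : X t₀ 1 ≤ 0) :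
    X T 1 ≤ -sqrt (X s 1 ^ 2 - 2 * ε ^ 2 * (T ^ 2 - s ^ 2)) := by
  rw [RotorKnob.rotorCircuit_eq_fiveGate] at hX
  obtain ⟨hσ0, hσε⟩ := knob_seed_le hε hρε hM
  have hμ : 0 ≤ ε⁻¹ * M := by positivity
  have hηε' : ε ≤ ε⁻¹ * M * η ^ 2 := by
    rw [mul_assoc, le_inv_mul_iff₀ hε]; nlinarith
  obtain ⟨hbT, hsq⟩ := clock_reversal hX h0 hε.le hσ0 hμ hs hη hηε' hc ht₀ hb₀
  have hsT : s ≤ T := ht₀.1.trans ht₀.2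
  have hcT0 : 0 ≤ X T 2 := hη.trans (hc T (right_mem_Icc.2 hsT))
  have hc2 : X T 2 ^ 2 ≤ X s 2 ^ 2 := pow_le_pow_left₀ hcT0 hcT 2
  have hT2 : 0 ≤ T ^ 2 - s ^ 2 := by nlinarith
  have hloss : ε * (ε + ρ ^ 2 * exp (-M)) * (T ^ 2 - s ^ 2) ≤ 2 * ε ^ 2 * (T ^ 2 - s ^ 2) := by
    have : ε * (ε + ρ ^ 2 * exp (-M)) ≤ 2 * ε ^ 2 := by nlinarith
    exact mul_le_mul_of_nonneg_right this hT2
  have hsq' : X s 1 ^ 2 - 2 * ε ^ 2 * (T ^ 2 - s ^ 2) ≤ X T 1 ^ 2 := by linarith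
  have h1 := sqrt_le_sqrt hsq'
  rw [sqrt_sq_eq_abs, abs_of_nonpos hbT] at h1
  linarith

/-- **CLOCK TRANSIT, knob family.** Along `rotorCircuit K M ε ρ` (`0 < ε`, `0 ≤ M`), if `c ≥ γ ≥ 0`
on `[T₁,T₂]` with `Mγ² > ε²`, the clock crosses a band `[-β, β]` inside the window in time
`t - s ≤ 2εβ/(Mγ² - ε²)`. [cite: Tao2016AveragedNS, §5.5 (b-eq)] -/
theorem knob_clock_transit {K M ε ρ : ℝ} {X : ℝ → Fin 5 → ℝ}
    (hX : ∀ t, HasDerivAt X (RotorKnob.rotorCircuit K M ε ρ (X t)) t) (h0 : X 0 = delayInit)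
    (hε : 0 < ε) (hM : 0 ≤ M) {T₁ T₂ γ β : ℝ} (hγ : 0 ≤ γ) (hγε : ε ^ 2 < M * γ ^ 2)
    (hc : ∀ t ∈ Icc T₁ T₂, γ ≤ X t 2) {s t : ℝ} (hs : s ∈ Icc T₁ T₂) (ht : t ∈ Icc T₁ T₂)
    (hst : s ≤ t) (hbs : X s 1 ≤ β) (hbt : -β ≤ X t 1) :
    t - s ≤ 2 * ε * β / (M * γ ^ 2 - ε ^ 2) := by
  rw [RotorKnob.rotorCircuit_eq_fiveGate] at hX
  have hμ : 0 ≤ ε⁻¹ * M := by positivity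
  have hγε' : ε < ε⁻¹ * M * γ ^ 2 := by
    rw [mul_assoc, lt_inv_mul_iff₀ hε]; nlinarith
  have h := clock_transit hX h0 hε.le hμ hγ hγε' hc hs ht hst hbs hbt
  have heq : 2 * β / (ε⁻¹ * M * γ ^ 2 - ε) = 2 * ε * β / (M * γ ^ 2 - ε ^ 2) := by
    have hne : M * γ ^ 2 - ε ^ 2 ≠ 0 := by linarith
    have hne' : ε⁻¹ * M * γ ^ 2 - ε ≠ 0 := by linarith
    field_simp
  linarith [heq ▸ h]

/-- **RISE RESIDENCE, knob family.** Along `rotorCircuit K M ε ρ` (`0 < ρ² ≤ ε`, `0 < M`), if the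
clock is alive at level `b ≥ β > 0` on `[T₁,T₂] ⊆ [0,∞)` and at a time `s` of the window the
trigger has reached `u(s) = c(s)/ρ² ≥ λ > 0`, then for every later `t` in the window
`t - s ≤ (ε/(Mβ))·log(2εt/(λρ²))` (`μβ = Mβ/ε`; budget `c ≤ 2εt`): with `β ≈ ε`, the residence of
`u` between `λ` and its peak `≈ √2/σ_knob` (`σ_knob = ρ²/ε`) with the clock alive is
`≲ log(2t/(λσ_knob))/M`. [cite: Tao2016AveragedNS, §5.5 (5.5), proof (ob-2)] -/
theorem knob_rise_residence {K M ε ρ : ℝ} {X : ℝ → Fin 5 → ℝ}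
    (hX : ∀ t, HasDerivAt X (RotorKnob.rotorCircuit K M ε ρ (X t)) t) (h0 : X 0 = delayInit)
    (hε : 0 < ε) (hρ : 0 < ρ) (hρε : ρ ^ 2 ≤ ε) (hM : 0 < M) {T₁ T₂ β lam : ℝ} (hT₁ : 0 ≤ T₁)
    (hβ : 0 < β) (hb : ∀ t ∈ Icc T₁ T₂, β ≤ X t 1) {s t : ℝ} (hs : s ∈ Icc T₁ T₂)
    (ht : t ∈ Icc T₁ T₂) (hst : s ≤ t) (hlam : 0 < lam) (hus : lam * ρ ^ 2 ≤ X s 2) :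
    t - s ≤ ε * log (2 * ε * t / (lam * ρ ^ 2)) / (M * β) := by
  rw [RotorKnob.rotorCircuit_eq_fiveGate] at hX
  obtain ⟨hσ0, hσε⟩ := knob_seed_le hε hρε hM.le
  have hμ : 0 < ε⁻¹ * M := by positivity
  have hℓ : 0 < lam * ρ ^ 2 := by positivity
  have h := rise_residence hX h0 hε.le hσ0 hμ hT₁ hβ hb hs ht hst hℓ hus
  -- the budget `(ε + ρ²e^{-M})t ≤ 2εt` inside the logarithm (`t ≥ 0`; if `t = 0` then `s = t`)
  have ht0 : 0 ≤ t := hT₁.trans ht.1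
  rcases ht0.eq_or_lt with ht00 | htpos
  · have : s = 0 := le_antisymm (ht00 ▸ hst) (hT₁.trans hs.1)
    rw [← ht00, this, sub_self]
    have hlog : 2 * ε * (0 : ℝ) / (lam * ρ ^ 2) = 0 := by simp
    rw [hlog, log_zero, mul_zero, zero_div]
  have hcs0 : 0 < X s 2 := hℓ.trans_le hus
  have harg : 0 < (ε + ρ ^ 2 * exp (-M)) * t / (lam * ρ ^ 2) := by positivity
  have hmono : log ((ε + ρ ^ 2 * exp (-M)) * t / (lam * ρ ^ 2))
      ≤ log (2 * ε * t / (lam * ρ ^ 2)) := by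
    refine log_le_log harg (div_le_div_of_nonneg_right ?_ hℓ.le)
    nlinarith
  have hk : 0 < ε⁻¹ * M * β := by positivity
  have h2 : t - s ≤ log (2 * ε * t / (lam * ρ ^ 2)) / (ε⁻¹ * M * β) :=
    h.trans (div_le_div_of_nonneg_right hmono hk.le)
  have heq : log (2 * ε * t / (lam * ρ ^ 2)) / (ε⁻¹ * M * β)
      = ε * log (2 * ε * t / (lam * ρ ^ 2)) / (M * β) := by
    field_simp
  linarith [heq ▸ h2]

/-- **DECAY RESIDENCE, knob family.** Along `rotorCircuit K M ε ρ` (`0 < ε`, `0 < ρ`, `0 < M`), if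
the clock is dead at level `b ≤ -β` (`β > 0`) on `[T,T'] ⊆ [0,∞)` and at `t ∈ [T,T']` the trigger
still holds `u(t) = c(t)/ρ² ≥ λ` with `λ` above the seed floor `εe^{-M}/(Mβ)` (in `u`-units), then
`t - T ≤ (ε/(Mβ))·log(u(T)/(λ - εe^{-M}/(Mβ)))`: the residence of `u` above `λ` after clock death
is `≲ log(u(T)/λ)/M` for `β ≈ ε` — LOGARITHMIC in the pulse height.
[cite: Tao2016AveragedNS, §5.5 (5.5), proof ("comparison argument")] -/
theorem knob_decay_residence {K M ε ρ : ℝ} {X : ℝ → Fin 5 → ℝ}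
    (hX : ∀ t, HasDerivAt X (RotorKnob.rotorCircuit K M ε ρ (X t)) t) (h0 : X 0 = delayInit)
    (hε : 0 < ε) (hρ : 0 < ρ) (hM : 0 < M) {T T' β lam : ℝ} (hT : 0 ≤ T) (hβ : 0 < β)
    (hb : ∀ t ∈ Icc T T', X t 1 ≤ -β) {t : ℝ} (ht : t ∈ Icc T T')
    (hlam : ε * exp (-M) / (M * β) < lam) (hut : lam * ρ ^ 2 ≤ X t 2) :
    t - T ≤ ε * log (X T 2 / ρ ^ 2 / (lam - ε * exp (-M) / (M * β))) / (M * β) := by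
  rw [RotorKnob.rotorCircuit_eq_fiveGate] at hX
  have hσ0 : 0 ≤ ρ ^ 2 * exp (-M) := by positivity
  have hμ : 0 < ε⁻¹ * M := by positivity
  have hρ2 : 0 < ρ ^ 2 := by positivity
  have hfloor : ρ ^ 2 * exp (-M) / (ε⁻¹ * M * β) = ρ ^ 2 * (ε * exp (-M) / (M * β)) := by
    field_simp
  have hℓ : ρ ^ 2 * exp (-M) / (ε⁻¹ * M * β) < lam * ρ ^ 2 := by
    rw [hfloor]; nlinarith
  have h := decay_residence hX h0 hσ0 hμ hT hβ hb ht hℓ hut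
  have heq1 : X T 2 / (lam * ρ ^ 2 - ρ ^ 2 * exp (-M) / (ε⁻¹ * M * β))
      = X T 2 / ρ ^ 2 / (lam - ε * exp (-M) / (M * β)) := by
    rw [hfloor]
    have hne : lam - ε * exp (-M) / (M * β) ≠ 0 := by linarith
    field_simp
  have heq2 : log (X T 2 / ρ ^ 2 / (lam - ε * exp (-M) / (M * β))) / (ε⁻¹ * M * β)
      = ε * log (X T 2 / ρ ^ 2 / (lam - ε * exp (-M) / (M * β))) / (M * β) := by
    field_simp
  rw [heq1, heq2] at h
  exact h

end Summit.NavierStokesRegularity.FluidComputer.GateBudget
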